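/-
Copyright: fleet lead `ym-wcr-19609-p1` (seat prover-ym-wcr-19609-p1-g0-0), route `WeakCouplingRates`, crux
`BulkDominatesColdBoxW` (stmt-QuantumFields-19609), line `dlr-chessboard` (skeleton v4, sha16 355a68b80645dd42).
-/
import Summits.QuantumFields.YangMills.Theorems.WeakCouplingRatesBulkDominatesColdBoxWDefs
import Literature.MathematicalPhysics.QuantumFieldTheory.LatticeAxialGauge

/-!
# Small plaquettes ⇒ small links in the comb (axial) gauge — the SUP form of the discrete nonlinear Poincaré
# inequality (brick B1 toward the open stubs L1a/L1b of crux `BulkDominatesColdBoxW`, stmt-QuantumFields-19609)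

WHY.  The open stubs `stub_goodBoundaryCovStable` (L1a) and `stub_goodBoundaryMeanSmooth` (L1b) of the line `dlr-chessboard`
concern the box kernel `ymSpecification ρ β (boxEdges 4 (2H+1)) ω` UNIFORMLY over crude-good boundary data `ω`
(`CrudeGood β δ H ω`: every plaquette of `ω` based in the corona range `[−1, 2H+1]⁴` has cost `≤ β^{2δ−1}`).  Step 0 of any proof is
the reduction of a crude-good datum to a datum with SMALL LINKS: the kernel means of gauge-invariant observables are invariant under
gauge transformations of `ω` (tree `ymSpecification_map_gaugeTransformZd_holds`), and after Chatterjee's comb (axial) gauge on a cube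
all of whose plaquettes are small, every link is small — by the SUP form of the discrete Poincaré inequality proved here:

* `AxialGaugeSup.le_l1_mul_of_plaquette_le` — for a length function `ℓ ≥ 0` on `G` (`ℓ(ab) ≤ ℓ a + ℓ b`, `ℓ(a⁻¹) = ℓ a`) and a
  configuration `U` with `ℓ = 0` on the comb-tree edges of `B_n = [0,n)^d`: if every plaquette of `B_n` has `ℓ(U_p) ≤ M` then every
  edge `(x, j)` of `B_n` has `ℓ(U(x,j)) ≤ |x|₁ · M` (the same induction on `|x|₁` as the tree's L² form
  `AxialGauge.sq_le_l1_mul_sum`, Chatterjee arXiv:1602.01222 Lemma 10.2, with the plaquette `(x − e_k, j, k)`);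
* `AxialGaugeSup.le_mul_of_plaquette_le_gaugeFix` — the same for the gauge-fixed configuration `gaugeFix U` of an ARBITRARY `U`
  (comb edges of `gaugeFix U` are `1`; plaquettes of `gaugeFix U` are conjugates of those of `U`, so a conjugation-invariant `ℓ`
  bound transfers): `ℓ((gaugeFix U)(x,j)) ≤ |x|₁ · M ≤ d·n·M`.

WHAT THIS IS NOT.  Pure group/lattice combinatorics for every group `G`; no measure, no `SU(2)`; not a claim about the mass gap.

References: S. Chatterjee, *The leading term of the Yang–Mills free energy*, JFA 271 (2016), arXiv:1602.01222, §9 (comb gauge),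
Lemma 10.2 (Poincaré inequality).
-/

set_option autoImplicit false

noncomputable section

open Finset
open Literature.Probability.LatticeModels Literature.MathematicalPhysics.QuantumLattice
open Literature.MathematicalPhysics.QuantumFieldTheory Literature.MathematicalPhysics.QuantumFieldTheory.AxialGauge

namespace Summit.QuantumFields.YangMills.Theorems.WeakCouplingRates.AxialGaugeSup

variable {d : ℕ} {G : Type*} [Group G]

/-- **The discrete nonlinear Poincaré inequality, sup form.**  Let `ℓ` be a length function on `G` (`ℓ(ab) ≤ ℓ a + ℓ b`,
`ℓ(a⁻¹) = ℓ a`; non-negativity is not needed) and let `U` be a configuration with `ℓ(U_e) = 0` on the comb-tree edges of the cube `B_n`.  If every plaquette of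
`B_n` has `ℓ(U_p) ≤ M` (`M ≥ 0`), then for every edge `(x, j)` of `B_n`, `ℓ(U(x,j)) ≤ |x|₁ · M` (induction on `|x|₁` with the plaquette
`(x − e_k, j, k)`, `k` the largest index with `x_k ≠ 0`, which has two comb edges; Chatterjee proves the L² form).
[cite: arXiv160201222, Lemma 10.2] -/
theorem le_l1_mul_of_plaquette_le {ℓ : G → ℝ} (hmul : ∀ a b, ℓ (a * b) ≤ ℓ a + ℓ b)
    (hinv : ∀ a, ℓ a⁻¹ = ℓ a) {n : ℕ} {U : ZdGaugeConfig d G}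
    (hU : ∀ e ∈ boxEdges d n, IsComb e → ℓ (U e) = 0) {M : ℝ} (hM0 : 0 ≤ M)
    (hM : ∀ p ∈ plaquettesIn (halfOpenBox d n), ℓ (U.plaquette p.1 p.2.1 p.2.2) ≤ M)
    {e : Literature.Probability.LatticeModels.Site d × Fin d} (he : e ∈ boxEdges d n) :
    ℓ (U e) ≤ l1 e.1 * M := by
  set P := plaquettesIn (halfOpenBox d n) with hP
  suffices H : ∀ (m : ℕ) (x : Literature.Probability.LatticeModels.Site d) (j : Fin d),
      (x, j) ∈ boxEdges d n → l1 x = m → ℓ (U (x, j)) ≤ m * M by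
    obtain ⟨x, j⟩ := e
    exact H _ x j he rfl
  intro m
  induction m using Nat.strong_induction_on with
  | _ m ih =>
  intro x j hxj hm
  by_cases hc : IsComb (x, j)
  · rw [hU _ hxj hc]
    exact mul_nonneg (Nat.cast_nonneg m) hM0
  -- the largest index `k` with `x_k ≠ 0`; it exceeds `j`
  obtain ⟨hbox, hxjn⟩ := mem_boxEdges_iff.1 hxj
  have hne : (univ.filter fun k : Fin d => x k ≠ 0).Nonempty := by
    simp only [IsComb, not_forall, exists_prop] at hc
    obtain ⟨k, -, hk⟩ := hc
    exact ⟨k, mem_filter.2 ⟨mem_univ _, hk⟩⟩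
  set k := (univ.filter fun k : Fin d => x k ≠ 0).max' hne with hk
  have hkx : x k ≠ 0 := (mem_filter.1 (Finset.max'_mem _ hne)).2
  have hkmax : ∀ k' : Fin d, k < k' → x k' = 0 := fun k' hk' => by
    by_contra h
    exact absurd (Finset.le_max' _ k' (mem_filter.2 ⟨mem_univ _, h⟩)) (not_le.2 hk')
  have hjk : j < k := by
    by_contra h
    simp only [IsComb, not_forall, exists_prop] at hc
    obtain ⟨k', hk', hk'0⟩ := hc
    exact hk'0 (hkmax k' (lt_of_le_of_lt (not_lt.1 h) hk'))
  have hxk : 1 ≤ x k := by have := (hbox k).1; omega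
  -- the predecessor `z = x - e_k`
  set z : Literature.Probability.LatticeModels.Site d := x - Pi.single k 1 with hz
  have hxz : x = z + Pi.single k 1 := by rw [hz, sub_add_cancel]
  have hzk : 0 ≤ z k := by simp [hz]; omega
  have hzc : ∀ k' : Fin d, k' ≠ k → z k' = x k' := fun k' hk' => by simp [hz, Pi.single_eq_of_ne hk']
  have hzbox : ∀ k', 0 ≤ z k' ∧ z k' < n := fun k' => by
    by_cases h : k' = k
    · subst h; constructor <;> [exact hzk; (simp [hz]; linarith [(hbox k).2])]
    · rw [hzc k' h]; exact hbox k'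
  have hzj : (z, j) ∈ boxEdges d n :=
    mem_boxEdges_iff.2 ⟨hzbox, by rw [hzc j (ne_of_lt hjk)]; exact hxjn⟩
  -- `|z|₁ = m - 1`
  have hl1 : l1 x = l1 z + 1 := by rw [hxz, l1_add_single hzk]
  have hm' : l1 z = m - 1 := by omega
  have hm1 : 1 ≤ m := by omega
  -- the two comb edges of the plaquette `(z, j, k)`
  have hc1 : IsComb (z, k) := fun k' hk' => by
    dsimp only at hk' ⊢
    rw [hzc k' (ne_of_gt hk')]; exact hkmax k' hk'
  have hc2 : IsComb (z + Pi.single j 1, k) := fun k' hk' => by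
    dsimp only at hk' ⊢
    rw [Pi.add_apply, Pi.single_eq_of_ne (ne_of_gt (hjk.trans hk')), add_zero, hzc k' (ne_of_gt hk')]
    exact hkmax k' hk'
  have he1 : (z, k) ∈ boxEdges d n :=
    mem_boxEdges_iff.2 ⟨hzbox, by simp [hz]; exact (hbox k).2⟩
  have he2 : (z + Pi.single j 1, k) ∈ boxEdges d n := by
    refine mem_boxEdges_iff.2 ⟨fun k' => ?_, ?_⟩
    · by_cases h : k' = j
      · subst h
        simp only [Pi.add_apply, Pi.single_eq_same, hzc _ (ne_of_lt hjk)]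
        constructor <;> linarith [(hbox k').1]
      · rw [Pi.add_apply, Pi.single_eq_of_ne h, add_zero]; exact hzbox k'
    · simp only [Pi.add_apply, Pi.single_eq_of_ne (ne_of_gt hjk), add_zero]
      simp [hz]; exact (hbox k).2
  -- the plaquette `p₀ = (z, j, k)` lies in `B_n`
  have hp₀ : ((z, j, k) : Plaq d) ∈ P := by
    rw [hP, Plaq.mem_plaquettesIn]
    refine ⟨mem_halfOpenBox.2 hzbox, hjk, (mem_boxEdges.1 hzj).2, ?_, ?_⟩
    · rw [← hxz]; exact mem_halfOpenBox.2 hbox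
    · dsimp only
      rw [add_right_comm, ← hxz]
      exact (mem_boxEdges.1 hxj).2
  -- holonomy algebra: `ℓ(U(x,j)) ≤ ℓ(U(z,j)) + ℓ(U_{p₀})`
  have hhol : U.plaquette z j k = U (z, j) * U (z + Pi.single j 1, k) * (U (x, j))⁻¹ * (U (z, k))⁻¹ := by
    rw [ZdGaugeConfig.plaquette, ← hxz]
  have hstep : ℓ (U (x, j)) ≤ ℓ (U (z, j)) + ℓ (U.plaquette z j k) := by
    have e1 : (U (x, j))⁻¹ = (U (z + Pi.single j 1, k))⁻¹ * (U (z, j))⁻¹ * U.plaquette z j k * U (z, k) := by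
      rw [hhol]; group
    calc ℓ (U (x, j)) = ℓ (U (x, j))⁻¹ := (hinv _).symm
      _ ≤ ℓ ((U (z + Pi.single j 1, k))⁻¹ * (U (z, j))⁻¹ * U.plaquette z j k) + ℓ (U (z, k)) := by
          rw [e1]; exact hmul _ _
      _ ≤ ℓ ((U (z + Pi.single j 1, k))⁻¹ * (U (z, j))⁻¹) + ℓ (U.plaquette z j k) + ℓ (U (z, k)) := by
          gcongr; exact hmul _ _
      _ ≤ ℓ (U (z + Pi.single j 1, k))⁻¹ + ℓ (U (z, j))⁻¹ + ℓ (U.plaquette z j k) + ℓ (U (z, k)) := by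
          gcongr; exact hmul _ _
      _ = ℓ (U (z, j)) + ℓ (U.plaquette z j k) := by
          rw [hinv, hinv, hU _ he2 hc2, hU _ he1 hc1]; ring
  -- induction hypothesis at `(z, j)` and the plaquette bound at `p₀`
  have ih' := ih (m - 1) (by omega) z j hzj hm'
  have hpl : ℓ (U.plaquette z j k) ≤ M := hM _ hp₀
  have hm_cast : ((m - 1 : ℕ) : ℝ) + 1 = m := by
    rw [Nat.cast_sub hm1]; push_cast; ring
  calc ℓ (U (x, j)) ≤ ℓ (U (z, j)) + ℓ (U.plaquette z j k) := hstep
    _ ≤ ((m - 1 : ℕ) : ℝ) * M + M := add_le_add ih' hpl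
    _ = (m : ℝ) * M := by rw [← hm_cast]; ring

/-- `|x|₁ ≤ d (n - 1) ≤ d n` on the cube `B_n` (the tree's `l1_le` in the form used here). [folklore] -/
theorem l1_le_mul {n : ℕ} {x : Literature.Probability.LatticeModels.Site d} (hx : ∀ k, 0 ≤ x k ∧ x k < n) :
    (l1 x : ℝ) ≤ d * n := by
  have h : ∀ k, (x k).toNat ≤ n := fun k => by have := hx k; omega
  have hs : l1 x ≤ ∑ _k : Fin d, n := Finset.sum_le_sum fun k _ => h k
  rw [Finset.sum_const, Finset.card_univ, Fintype.card_fin, smul_eq_mul] at hs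
  exact_mod_cast hs

/-- **Small plaquettes ⇒ small links in the comb gauge.**  For a length function `ℓ` on `G` (`ℓ 1 = 0`) that is ALSO conjugation invariant
(`ℓ(h g h⁻¹) = ℓ g`, e.g. any bi-invariant distance to `1`, `‖ρ(·) − 1‖` for a unitary representation) and ANY configuration `U` on
`ℤ^d`: if every plaquette of the cube `B_n` has `ℓ(U_p) ≤ M`, then every edge `(x, j)` of `B_n` has, after Chatterjee's comb gauge
fixing `gaugeFix U = G_U · U`, `ℓ((gaugeFix U)(x, j)) ≤ |x|₁ · M ≤ d · n · M` (comb edges of `gaugeFix U` are `1`, its plaquettes are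
conjugates of those of `U`). [cite: arXiv160201222, Prop. 9.2 and Lemma 10.2] -/
theorem le_mul_of_plaquette_le_gaugeFix {ℓ : G → ℝ} (hmul : ∀ a b, ℓ (a * b) ≤ ℓ a + ℓ b)
    (hinv : ∀ a, ℓ a⁻¹ = ℓ a) (hone : ℓ 1 = 0) (hconj : ∀ g h : G, ℓ (h * g * h⁻¹) = ℓ g) {n : ℕ} (U : ZdGaugeConfig d G)
    {M : ℝ} (hM0 : 0 ≤ M) (hM : ∀ p ∈ plaquettesIn (halfOpenBox d n), ℓ (U.plaquette p.1 p.2.1 p.2.2) ≤ M)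
    {e : Literature.Probability.LatticeModels.Site d × Fin d} (he : e ∈ boxEdges d n) :
    ℓ (gaugeFix U e) ≤ l1 e.1 * M ∧ ℓ (gaugeFix U e) ≤ d * n * M := by
  have hU : ∀ e ∈ boxEdges d n, IsComb e → ℓ (gaugeFix U e) = 0 := by
    rintro ⟨x, i⟩ hxi hc
    rw [gaugeFix_of_isComb hc ((mem_boxEdges_iff.1 hxi).1 i).1, hone]
  have hM' : ∀ p ∈ plaquettesIn (halfOpenBox d n), ℓ ((gaugeFix U).plaquette p.1 p.2.1 p.2.2) ≤ M := fun p hp => by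
    rw [plaquette_gaugeFix, hconj]; exact hM p hp
  have h1 := le_l1_mul_of_plaquette_le hmul hinv hU hM0 hM' he
  refine ⟨h1, h1.trans ?_⟩
  obtain ⟨x, i⟩ := e
  exact mul_le_mul_of_nonneg_right (l1_le_mul (mem_boxEdges_iff.1 he).1) hM0

end Summit.QuantumFields.YangMills.Theorems.WeakCouplingRates.AxialGaugeSup
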